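import Summits.ResolutionOfSingularities.ResolutionOfSingularities.Theorems.MarkedTransferCampaignW46CuspStaircaseDescent
import Summits.ResolutionOfSingularities.ResolutionOfSingularities.Theorems.MarkedTransferCampaignW46MohWindowNabla
import HarnessLib

/-!
# [OURS · L1 W4.6, rung (iii)] The cusp staircase — the window is the last stair: K4.6's boundary `B(p) = 2p` read
# intrinsically through the cusp index (cell res-hironaka, LADDER-RESOLUTION rung L, D-0089; slot W4.6,
# seat res-L1-s46-pv-5; host route MarkedTransfer, `--supports stmt-ResolutionOfSingularities-16155 --as helper`)

HONEST FRAMING. Nothing here is a statement of H. Hironaka's manuscript (2017-03-23, [Hironaka2017]) and nothing here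
asserts that any statement of it holds. These are THEOREMS about the OURS definitions of
`Theorems/MarkedTransferCampaignW46MohWindow.lean` (`MohWindowAt`, `Regime.mohWindowCurve`) and
`Theorems/MarkedTransferCampaignW46CuspStaircase.lean` (`CuspAt`, `cuspIndex`, `cuspIndexAt`, `Regime.cuspCurve`) over the
shared typed-procedure module (res-L1-type-o1), assembled from this seat's files `…MohWindowProof` /
`…MohWindowBoundary` / `…MohWindowNabla` / `…CuspStaircaseProof` / `…CuspStaircaseDescent`. No FACT-LIST premise; no
`sorry`; axioms standard. AI review is weaker than expert review.

## What is proved (namespace `…Theorems.CampaignW46`)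

K4.6 (res-L0-k46, j258573) found the boundary `B(p) = 2p` on the cusps `y^p + xⁿ`, `p ∤ n`: the typed one-step certificate
holds at a stage iff the blown-up cusp has `n < 2p`. With the intrinsic cusp index of `…CuspStaircase` this boundary is a
DICHOTOMY valid at EVERY typed step on the whole staircase (other singular points arbitrary cusp points):

* ring level: `Cusp.cuspIndex_lt_two_mul_of_mohWindowAt` / `Cusp.mohWindowAt_of_cuspIndex_lt` /
  `Cusp.mohWindowAt_iff_of_le_pow` — at an ideal inside `𝔪^b`, «window germ» ⟺ «cusp germ with index `< 2b`»;
  `Regime.mohWindowCurve_iff` — at a singular state, the window regime = the staircase regime with all indices `< 2b`.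
* `Step.sing_finite_and_ncard_lt_of_cuspIndexAt_lt` — **last stair**: if the CENTRE `ξ` of a typed step from a state in
  `Regime.cuspCurve` has `index(ξ) < 2b`, then `Sing(E′)` is finite and `#Sing(E′) < #Sing(E)` (no singular point over
  `ξ`, `MohWindow.idealOrder_controlledTransform_lt`; injective off `ξ`) — the Eq. (127)-role invariant `#Sing` of the
  window rung drops, whatever the other singular points are.
* `Step.exists_mem_sing_over_of_le_cuspIndexAt` — **higher stairs**: if `index(ξ) ≥ 2b`, then SOME point of `Sing(E′)`
  lies over `ξ`, again a cusp point, with `index + b ≤ index(ξ)` (`Step.exists_cuspShape_over_of_le` at the least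
  presentation; `Step.cuspAt_and_cuspIndexAt_le_of_over`) — `#Sing` does not drop over `ξ` while OUR multiset invariant
  does (`Step.isDershowitzMannaLT_cuspMultiset`).
* `Step.sing_ncard_lt_or_exists_over` — the dichotomy in one line.

## References

* `Theorems/MarkedTransferCampaignW46MohWindow*.lean`, `…CuspStaircase*.lean` (this seat); L/res-L0-k46/KILL-TEST-K4.6.md
  §3–§4 (`B(p) = 2p`; 59/59 rows `n > 2p` fail at step 1, 13/13 window rows hold; ATLAS-RUN j259568).
* H. Hironaka, ms. 2017-03-23, Th. 16.6 p.84 l.4–20 — scope only, under adjudication, not cited as fact. [Hironaka2017]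
-/

noncomputable section

set_option linter.dupNamespace false -- mandated namespace of this single-conjunct summit

open CategoryTheory AlgebraicGeometry TopologicalSpace IsLocalRing

namespace Summit.ResolutionOfSingularities.ResolutionOfSingularities.Theorems

namespace CampaignW46

open Literature.AlgebraicGeometry.Resolution
open Literature.AlgebraicGeometry.Hironaka2017.S02Preliminaries
open Literature.AlgebraicGeometry.Hironaka2017.Datum
open Scheme.IdealSheafData

universe u

namespace Cusp

/-! ## Ring level: the window is «index < 2b» -/

variable {S : Type u} [CommRing S] [IsLocalRing S] {b : ℕ} {I : Ideal S}

/-- A window germ (`b < d < 2b`) has cusp index `< 2b`. [folklore] -/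
theorem cuspIndex_lt_two_mul_of_mohWindowAt (h : MohWindowAt b S I) : cuspIndex b S I < 2 * b := by
  obtain ⟨hreg, hdim, x, y, hxy, d, u, hu, hbd, hd2, hI⟩ := h
  -- the admissible exponent `d` itself bounds the index
  have hnd : ¬ b ∣ d := by
    rintro ⟨k, hk⟩
    rcases Nat.lt_or_ge k 2 with hk2 | hk2
    · interval_cases k <;> omega
    · have := Nat.mul_le_mul_left b hk2
      omega
  exact lt_of_le_of_lt (cuspIndex_le hnd ⟨hreg, hdim, x, y, hxy, u, hu, hI⟩) hd2

/-- Conversely, a cusp germ inside `𝔪^b` with index `< 2b` is a window germ (its least presentation has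
`b < d < 2b`, the lower bound by order additivity, `lt_of_cuspShape_of_le_pow`). [folklore] -/
theorem mohWindowAt_of_cuspIndex_lt (h : CuspAt b S I) (hle : I ≤ maximalIdeal S ^ b)
    (hlt : cuspIndex b S I < 2 * b) : MohWindowAt b S I := by
  obtain ⟨hnd, hreg, hdim, x, y, hxy, u, hu, hI⟩ := cuspIndex_spec h
  exact ⟨hreg, hdim, x, y, hxy, cuspIndex b S I, u, hu,
    lt_of_cuspShape_of_le_pow ⟨hreg, hdim, x, y, hxy, u, hu, hI⟩ hnd hle, hlt, hI⟩

/-- **The window is «cusp index `< 2b`»** for ideals inside `𝔪^b` (i.e. at singular points). [folklore] -/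
theorem mohWindowAt_iff_of_le_pow (hle : I ≤ maximalIdeal S ^ b) :
    MohWindowAt b S I ↔ CuspAt b S I ∧ cuspIndex b S I < 2 * b :=
  ⟨fun h => ⟨h.cuspAt, cuspIndex_lt_two_mul_of_mohWindowAt h⟩,
    fun h => mohWindowAt_of_cuspIndex_lt h.1 hle h.2⟩

end Cusp

/-! ## State level -/

section State

variable {n : ℕ} {p : ℕ} [Fact p.Prime] {K : Type u} [Field K] [CharP K p]
variable {N : Notions.{u} n} {A A' : AmbientDatum p K} {E : IdealExponent A.Z} {R : Resume N A E}

/-- At a singular point, `J_ξ ⊆ 𝔪_ξ^b`. [folklore] -/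
theorem stalkIdeal_le_pow_of_mem_sing {ξ : A.Z} (hξ : ξ ∈ E.sing) :
    stalkIdeal E.J ξ ≤ maximalIdeal (A.Z.presheaf.stalk ξ) ^ E.b :=
  (le_idealOrder_iff _ _ _).mp hξ

/-- [OURS · L1 W4.6 rung (iii); NOT a statement of the manuscript] **The window regime is the staircase regime with all
indices below `2b`** (at a singular state; at a resolved state both say nothing about germs, and the staircase regime
additionally records `0 < b`). [folklore] -/
theorem Regime.mohWindowCurve_iff (hne : E.sing.Nonempty) :
    Regime.mohWindowCurve A E ↔ Regime.cuspCurve A E ∧ ∀ ξ ∈ E.sing, cuspIndexAt E ξ < 2 * E.b := by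
  constructor
  · intro h
    refine ⟨Regime.cuspCurve_of_mohWindowCurve h hne, fun ξ hξ => ?_⟩
    exact Cusp.cuspIndex_lt_two_mul_of_mohWindowAt (h.2.2 ξ hξ)
  · rintro ⟨⟨-, hfin, hcl, hcusp⟩, hlt⟩
    exact ⟨hfin, hcl, fun ξ hξ =>
      Cusp.mohWindowAt_of_cuspIndex_lt (hcusp ξ hξ) (stalkIdeal_le_pow_of_mem_sing hξ) (hlt ξ hξ)⟩

/-- [OURS · L1 W4.6 rung (iii); NOT a statement of the manuscript] **Last stair: over a centre of index `< 2b` the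
singular locus strictly shrinks.** For a state in `Regime.cuspCurve` and a typed step blowing up the closed point `ξ`
with `cuspIndexAt E ξ < 2 * E.b` (the other singular points being arbitrary cusp points), `Sing(E′)` is finite and
`#Sing(E′) < #Sing(E)`: no point over `ξ` is singular (`MohWindow.idealOrder_controlledTransform_lt` at the least
presentation, a window germ), orders off `ξ` are unchanged and `π` is injective there. [folklore] -/
theorem Step.sing_finite_and_ncard_lt_of_cuspIndexAt_lt (s : Step R A') (hRg : Regime.cuspCurve A E) {ξ : A.Z}
    (hDξ : (s.D : Set A.Z) = {ξ}) (hlt : cuspIndexAt E ξ < 2 * E.b) :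
    s.E'.sing.Finite ∧ s.E'.sing.ncard < E.sing.ncard := by
  classical
  obtain ⟨-, hfin, hcl, hcusp⟩ := hRg
  haveI : IsLocallyNoetherian A'.Z := by
    haveI := A'.smooth
    exact LocallyOfFiniteType.isLocallyNoetherian A'.hom
  have hπ : IsBlowup s.π (vanishingIdeal s.D) := s.blowup
  have hξS : ξ ∈ E.sing := by
    apply s.centre.subset_sing
    rw [hDξ]
    exact Set.mem_singleton _
  have hξcl : IsClosed ({ξ} : Set A.Z) := hcl hξS
  have hW : MohWindowAt E.b (A.Z.presheaf.stalk ξ) (stalkIdeal E.J ξ) :=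
    Cusp.mohWindowAt_of_cuspIndex_lt (hcusp ξ hξS) (stalkIdeal_le_pow_of_mem_sing hξS) hlt
  -- the singular points of `E′` lie over `Sing(E) ∖ {ξ}`
  have hmaps : Set.MapsTo s.π.base s.E'.sing (E.sing \ {ξ}) := by
    intro x' hx'
    have hx'b : (E.b : ℕ∞) ≤ idealOrder (controlledTransform s.π (vanishingIdeal s.D) E.J E.b) x' := hx'
    have hne : s.π.base x' ≠ ξ := by
      intro heq
      have hY : stalkIdeal (vanishingIdeal s.D) (s.π.base x') =
          maximalIdeal (A.Z.presheaf.stalk (s.π.base x')) := by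
        apply stalkIdeal_vanishingIdeal_eq_maximalIdeal_of_closure_eq
        rw [hDξ, heq, hξcl.closure_eq]
      have hW' : MohWindowAt E.b (A.Z.presheaf.stalk (s.π.base x')) (stalkIdeal E.J (s.π.base x')) := by
        rw [heq]; exact hW
      exact (not_le.mpr (MohWindow.idealOrder_controlledTransform_lt hπ hY hW')) hx'b
    have hnot : s.π.base x' ∉ (vanishingIdeal s.D).support := by
      rw [← SetLike.mem_coe, coe_support_vanishingIdeal, hDξ]
      exact hne
    refine ⟨?_, hne⟩
    show (E.b : ℕ∞) ≤ idealOrder E.J (s.π.base x')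
    rw [← hπ.idealOrder_controlledTransform_eq_of_not_mem_support E.J E.b hnot]
    exact hx'b
  have hinj : Set.InjOn s.π.base s.E'.sing := by
    refine (MohWindow.injOn_preimage_compl hπ).mono fun x' hx' => ?_
    show s.π.base x' ∈ (s.D : Set A.Z)ᶜ
    rw [hDξ]
    exact (hmaps hx').2
  have hfin' : s.E'.sing.Finite :=
    Set.Finite.of_finite_image ((hfin.subset fun _ hx => hx.1).subset hmaps.image_subset) hinj
  refine ⟨hfin', ?_⟩
  have hle : s.E'.sing.ncard ≤ (E.sing \ {ξ}).ncard :=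
    Set.ncard_le_ncard_of_injOn s.π.base hmaps hinj (hfin.subset fun _ hx => hx.1)
  have hdiff : (E.sing \ {ξ}).ncard = E.sing.ncard - 1 := Set.ncard_sdiff_singleton_of_mem hξS
  have hpos : 0 < E.sing.ncard := (Set.ncard_pos hfin).mpr ⟨ξ, hξS⟩
  omega

/-- [OURS · L1 W4.6 rung (iii); NOT a statement of the manuscript] **Higher stairs: over a centre of index `≥ 2b` a
singular cusp point survives, one stair down.** For a state in `Regime.cuspCurve` and a typed step blowing up the
closed point `ξ` with `2 * E.b ≤ cuspIndexAt E ξ`, some `x′ ∈ Sing(E′)` lies over `ξ`; every such `x′` is a cusp point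
with `cuspIndexAt E′ x′ + b ≤ cuspIndexAt E ξ`. [folklore] -/
theorem Step.exists_mem_sing_over_of_le_cuspIndexAt (s : Step R A') (hRg : Regime.cuspCurve A E) {ξ : A.Z}
    (hDξ : (s.D : Set A.Z) = {ξ}) (hle : 2 * E.b ≤ cuspIndexAt E ξ) :
    ∃ x' ∈ s.E'.sing, s.π.base x' = ξ ∧ CuspAt E.b (A'.Z.presheaf.stalk x') (stalkIdeal s.E'.J x') ∧
      cuspIndexAt s.E' x' + E.b ≤ cuspIndexAt E ξ := by
  obtain ⟨hb, -, hcl, hcusp⟩ := id hRg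
  have hξS : ξ ∈ E.sing := by
    apply s.centre.subset_sing
    rw [hDξ]
    exact Set.mem_singleton _
  have hξcl : IsClosed ({ξ} : Set A.Z) := hcl hξS
  obtain ⟨hnd, hshape⟩ := Cusp.cuspIndex_spec (hcusp ξ hξS)
  obtain ⟨x', hx', hπx', -, -⟩ := s.exists_cuspShape_over_of_le hDξ hξcl hb hle hnd hshape
  exact ⟨x', hx', hπx', s.cuspAt_and_cuspIndexAt_le_of_over hRg hDξ hx' hπx'⟩

/-- [OURS · L1 W4.6 rung (iii); NOT a statement of the manuscript] **The dichotomy at every typed step on the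
staircase** (K4.6's `B(p) = 2p`, intrinsically): for a state in `Regime.cuspCurve` and a step `s` admitted by the typed
centre rule, with centre the closed point `ξ`: EITHER `index(ξ) < 2b` and `#Sing` strictly drops, OR `index(ξ) ≥ 2b`
and a singular cusp point survives over `ξ` with index lowered by at least `b`. [folklore] -/
theorem Step.sing_ncard_lt_or_exists_over (s : Step R A') (hRg : Regime.cuspCurve A E) :
    ∃ ξ : A.Z, (s.D : Set A.Z) = {ξ} ∧
      ((cuspIndexAt E ξ < 2 * E.b ∧ s.E'.sing.Finite ∧ s.E'.sing.ncard < E.sing.ncard) ∨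
       (2 * E.b ≤ cuspIndexAt E ξ ∧ ∃ x' ∈ s.E'.sing, s.π.base x' = ξ ∧
          CuspAt E.b (A'.Z.presheaf.stalk x') (stalkIdeal s.E'.J x') ∧
          cuspIndexAt s.E' x' + E.b ≤ cuspIndexAt E ξ)) := by
  obtain ⟨ξ, -, -, hDξ⟩ := s.centre.exists_eq_singleton_of_cuspCurve hRg
  refine ⟨ξ, hDξ, ?_⟩
  rcases Nat.lt_or_ge (cuspIndexAt E ξ) (2 * E.b) with hlt | hle
  · exact Or.inl ⟨hlt, s.sing_finite_and_ncard_lt_of_cuspIndexAt_lt hRg hDξ hlt⟩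
  · exact Or.inr ⟨hle, s.exists_mem_sing_over_of_le_cuspIndexAt hRg hDξ hle⟩

end State

end CampaignW46

end Summit.ResolutionOfSingularities.ResolutionOfSingularities.Theorems

end
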